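import Summits.QuantumFields.GaugeBoot.OneOverNMaster
import HarnessLib

/-!
# The `1/N` coefficients of a plaquette do not depend on the plaquette (gauge-boot, ADDENDUM 30 part I)

HONEST FRAMING (cell `pub-gaugeboot`, page 1 of every file): the venture produces certified bounds
on lattice expectations at stated coupling, gauge group, dimension and torus size; NOT a mass gap,
NOT a continuum limit, NOT a string tension; NOT Yang–Mills-summit-bearing (barriers
`FixedCouplingUltralocality`, `PerturbativeInvisibility`).  Strong-coupling `SO(N)` lattice gauge theory with free boundary
condition (S. Chatterjee, Comm. Math. Phys. **366** (2019); S. Chatterjee, J. Jafarov, arXiv:1604.04777); nothing about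
four-dimensional continuum Yang–Mills or a mass gap.

## Content

Towards the `1/N` EXPANSION OF THE FREE ENERGY (sibling `OneOverNFreeEnergy`): the coefficients `f_k(β, (∂p))` of the
expansion of the plaquette expectation are the same for all positively oriented plaquettes `p` of `ℤ^d`.  Abstractly
(`plaquette_independence_of`): for ANY family `F` obeying the UNIFORM finite-volume bound of
`OneOverNExpansionUniform.oneOverN_expansion_uniform` at every order (for all finite `Λ`), `F_{k+2}(β, (∂p)) = F_{k+2}(β, (∂q))`
whenever `|β| ≤ β₀(k+1)`: compare the bounds at order `k+1` for `(Λ, ∂p)` and for a translated / axis-permuted copy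
`(gΛ, ∂(gp))`, whose plaquette expectations agree (translation and axis-permutation covariance of the free-boundary theory,
siblings `PlaquetteStringSum`, `LatticeSymmetryPerm`), and let `N → ∞` (`eq_of_uniform_bounds`).  Also: translation of
neighbourhood conditions (`ball_shift`, `plaquetteWord_translate`).

Everything is `[folklore]` given the siblings.
-/

noncomputable section

open Filter Topology
open Literature.Probability.LatticeModels (Site box)
open Literature.MathematicalPhysics.QuantumLattice (ZdEdge ZdPlaquette)
open Literature.MathematicalPhysics.QuantumFieldTheory (latticeNorm)
open Literature.MathematicalPhysics.QuantumFieldTheory.Chatterjee2019LargeN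
open Literature.MathematicalPhysics.QuantumFieldTheory.Chatterjee2019LargeN.CoeffCatalanBoundProof

namespace Summit.QuantumFields.GaugeBoot

namespace StringDuality

variable {d : ℕ}

/-! ## Translating words and neighbourhood conditions -/

/-- The endpoints of a translated letter are the translated endpoints. [folklore] -/
theorem src_shift (e : DEdge d) (a : Site d) :
    DEdge.src ((((e.1.1 + a, e.1.2) : ZdEdge d), e.2) : DEdge d) = DEdge.src e + a := by
  unfold DEdge.src
  split_ifs <;> simp only [add_right_comm]

/-- The endpoints of a translated letter are the translated endpoints. [folklore] -/
theorem tgt_shift (e : DEdge d) (a : Site d) :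
    DEdge.tgt ((((e.1.1 + a, e.1.2) : ZdEdge d), e.2) : DEdge d) = DEdge.tgt e + a := by
  unfold DEdge.tgt
  split_ifs <;> simp only [add_right_comm]

/-- **`∂(p + a)` is `∂p` translated by `a`.** [cite: Chatterjee2019LargeN, §2.1 (the plaquette word)] -/
theorem plaquetteWord_translate (x a : Site d) (ij : {q : Fin d × Fin d // q.1 < q.2}) :
    plaquetteWord ⟨x + a, ij⟩ = (plaquetteWord ⟨x, ij⟩).map fun e : DEdge d => ((((e.1.1 + a, e.1.2) : ZdEdge d), e.2) : DEdge d) := by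
  simp only [plaquetteWord, List.map_cons, List.map_nil, add_right_comm _ a]

/-- **Neighbourhood conditions translate**: if the `r`-neighbourhood of the translated loop sequence lies in `Λ`, the
`r`-neighbourhood of the original lies in `Λ − a`. [folklore] -/
theorem ball_shift {Λ : Finset (Site d)} {r : ℝ} (s : LoopSeq d) (a : Site d)
    (h : ∀ l ∈ s.map (List.map fun e : DEdge d => ((((e.1.1 + a, e.1.2) : ZdEdge d), e.2) : DEdge d)), ∀ e ∈ l, ∀ v : Site d,
      latticeNorm (v - DEdge.src e) ≤ r ∨ latticeNorm (v - DEdge.tgt e) ≤ r → v ∈ Λ) :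
    ∀ l ∈ s, ∀ e ∈ l, ∀ v : Site d,
      latticeNorm (v - DEdge.src e) ≤ r ∨ latticeNorm (v - DEdge.tgt e) ≤ r → v ∈ Λ.image fun y => y + -a := by
  intro l hl e he v hv
  have hl' : l.map (fun e : DEdge d => ((((e.1.1 + a, e.1.2) : ZdEdge d), e.2) : DEdge d)) ∈
      s.map (List.map fun e : DEdge d => ((((e.1.1 + a, e.1.2) : ZdEdge d), e.2) : DEdge d)) := List.mem_map.mpr ⟨l, hl, rfl⟩
  have he' : ((((e.1.1 + a, e.1.2) : ZdEdge d), e.2) : DEdge d) ∈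
      l.map (fun e : DEdge d => ((((e.1.1 + a, e.1.2) : ZdEdge d), e.2) : DEdge d)) := List.mem_map.mpr ⟨e, he, rfl⟩
  have hva : v + a ∈ Λ := by
    refine h _ hl' _ he' (v + a) ?_
    rw [src_shift, tgt_shift, add_sub_add_right_eq_sub, add_sub_add_right_eq_sub]
    exact hv
  exact Finset.mem_image.mpr ⟨v + a, hva, by abel⟩

/-! ## Comparing coefficients through the uniform bound -/

/-- **Two loop sequences with the same finite-`N` expectations (in suitable volumes) have the same coefficients**, one order at
a time: if `|N^{k+1}(x_N − Σ_{i≤k} a_i N^{−i})| ≤ A` and `|N^{k+1}(x_N − Σ_{i≤k} b_i N^{−i})| ≤ A'` for all `N ≥ 2`, and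
`a_i = b_i` for `i < k`, then `a_k = b_k`. [folklore] -/
theorem eq_of_uniform_bounds {k : ℕ} {A A' : ℝ} (x : ℕ → ℝ) (a b : ℕ → ℝ) (hab : ∀ i, i < k → a i = b i)
    (ha : ∀ N : ℕ, 2 ≤ N → |(N : ℝ) ^ (k + 1) * (x N - ∑ i ∈ Finset.range (k + 1), a i / (N : ℝ) ^ i)| ≤ A)
    (hb : ∀ N : ℕ, 2 ≤ N → |(N : ℝ) ^ (k + 1) * (x N - ∑ i ∈ Finset.range (k + 1), b i / (N : ℝ) ^ i)| ≤ A') :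
    a k = b k := by
  -- `N |a_k − b_k| ≤ A + A'` for all `N ≥ 2`
  have key : ∀ N : ℕ, 2 ≤ N → (N : ℝ) * |a k - b k| ≤ A + A' := by
    intro N hN
    have hN0 : (0 : ℝ) < N := by exact_mod_cast (by omega : 0 < N)
    have hsum : ∑ i ∈ Finset.range (k + 1), a i / (N : ℝ) ^ i - ∑ i ∈ Finset.range (k + 1), b i / (N : ℝ) ^ i =
        (a k - b k) / (N : ℝ) ^ k := by
      rw [Finset.sum_range_succ, Finset.sum_range_succ,
        Finset.sum_congr rfl (fun i hi => by rw [hab i (Finset.mem_range.mp hi)])]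
      ring
    have hdiff : (N : ℝ) ^ (k + 1) * (x N - ∑ i ∈ Finset.range (k + 1), b i / (N : ℝ) ^ i) -
        (N : ℝ) ^ (k + 1) * (x N - ∑ i ∈ Finset.range (k + 1), a i / (N : ℝ) ^ i) = (N : ℝ) * (a k - b k) := by
      rw [← mul_sub, sub_sub_sub_cancel_left, hsum, pow_succ]
      field_simp
    calc (N : ℝ) * |a k - b k| = |(N : ℝ) * (a k - b k)| := by rw [abs_mul, abs_of_pos hN0]
      _ = _ := by rw [← hdiff]
      _ ≤ A' + A := (abs_sub _ _).trans (add_le_add (hb N hN) (ha N hN))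
      _ = A + A' := add_comm _ _
  by_contra hne
  have hpos : 0 < |a k - b k| := abs_pos.mpr (sub_ne_zero.mpr hne)
  -- choose `N` with `N |a_k − b_k| > A + A'`
  obtain ⟨N, hN⟩ := exists_nat_gt (max 2 ((A + A') / |a k - b k|))
  have hN2 : 2 ≤ N := by
    have : (2 : ℝ) < N := lt_of_le_of_lt (le_max_left _ _) hN
    exact_mod_cast this.le
  have h1 : (A + A') / |a k - b k| < N := lt_of_le_of_lt (le_max_right _ _) hN
  rw [div_lt_iff₀ hpos] at h1
  linarith [key N hN2]

/-! ## Plaquette independence -/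

/-- **The coefficients of a plaquette do not depend on the plaquette**, for any family `F` obeying the uniform finite-volume
bounds of the `1/N` expansion in every finite volume: for `|β| ≤ β₀(k+1)` and positively oriented plaquettes `p, q`,
`F_{k+2}(β, (∂p)) = F_{k+2}(β, (∂q))`.  (Translation and axis-permutation covariance of the free-boundary theory; the cubes are
permutation invariant and translate into translated cubes.)
[cite: Chatterjee2019LargeN, Corollary 3.4 («Let p be any plaquette»); ChatterjeeJafarov2016OneOverN, Theorem 3.1] -/
theorem plaquette_independence_of (hd : 2 ≤ d) {F : ℕ → ℝ → LoopSeq d → ℝ} {β₀ C L : ℕ → ℝ}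
    (hanti : ∀ k, β₀ (k + 1) ≤ β₀ k)
    (hQ : ∀ (k : ℕ) (β : ℝ), |β| ≤ β₀ k → ∀ (Λ : Finset (Site d)) (N : ℕ), 2 ≤ N → ∀ s : LoopSeq d, IsLoopSeq s →
      (∀ l ∈ s, ∀ e ∈ l, ∀ v : Site d,
        latticeNorm (v - DEdge.src e) ≤ ((k * (4 * (Nat.log 2 N + 3)) : ℕ) : ℝ) ∨
          latticeNorm (v - DEdge.tgt e) ≤ ((k * (4 * (Nat.log 2 N + 3)) : ℕ) : ℝ) → v ∈ Λ) →
      |(N : ℝ) ^ k * (phi N β Λ s - ∑ i ∈ Finset.range k, F (i + 2) β s / (N : ℝ) ^ i)| ≤ C k * L k ^ s.len) :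
    ∀ (k : ℕ) (β : ℝ), |β| ≤ β₀ (k + 1) → ∀ p q : ZdPlaquette d,
      F (k + 2) β [plaquetteWord p] = F (k + 2) β [plaquetteWord q] := by
  -- the canonical plaquette
  set i₀ : Fin d := ⟨0, by omega⟩
  set j₀ : Fin d := ⟨1, by omega⟩
  have h01 : i₀ < j₀ := by simp [i₀, j₀, Fin.lt_def]
  set p₀ : ZdPlaquette d := ⟨0, ⟨(i₀, j₀), h01⟩⟩
  -- depth of a plaquette based at `x ∈ [−r, r]^d` inside the cube of radius `r + R + 1`
  have hdepth : ∀ (R r : ℕ) (x : Site d), x ∈ box d r → ∀ ij : {q : Fin d × Fin d // q.1 < q.2},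
      ∀ l ∈ ([plaquetteWord ⟨x, ij⟩] : LoopSeq d), ∀ a ∈ l, ∀ v : Site d,
        latticeNorm (v - DEdge.src a) ≤ (R : ℕ) ∨ latticeNorm (v - DEdge.tgt a) ≤ (R : ℕ) → v ∈ box d (r + R + 1) := by
    intro R r x hx ij
    refine ball_plaquetteWord_box (M := r + R + 1) (R := R) (by omega) ?_ ij
    have : r + R + 1 - (R + 1) = r := by omega
    rw [this]; exact hx
  -- every point lies in some cube
  have hbox : ∀ x : Site d, ∃ r : ℕ, x ∈ box d r := by
    intro x
    obtain ⟨r, hr⟩ := exists_vertices_mem_box ([[(((x, i₀) : ZdEdge d), true)]] : LoopSeq d)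
    exact ⟨r, (hr _ (List.mem_singleton.mpr rfl) _ (List.mem_singleton.mpr rfl)).1⟩
  -- 0 lies in every cube
  have h0box : (0 : Site d) ∈ box d 0 := by rw [mem_box_iff]; intro i; simp
  -- ONE LEVEL: from the lower levels to level `k`
  have hstep : ∀ (k : ℕ) (β : ℝ), |β| ≤ β₀ (k + 1) →
      (∀ i, i < k → ∀ p : ZdPlaquette d, F (i + 2) β [plaquetteWord p] = F (i + 2) β [plaquetteWord p₀]) →
      ∀ p : ZdPlaquette d, F (k + 2) β [plaquetteWord p] = F (k + 2) β [plaquetteWord p₀] := by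
    intro k β hβ hlow p
    obtain ⟨x, ⟨⟨i, j⟩, hij⟩⟩ := p
    obtain ⟨r, hxr⟩ := hbox x
    -- the depth needed at order `k + 1`
    set R : ℕ → ℕ := fun N => (k + 1) * (4 * (Nat.log 2 N + 3)) with hR
    -- step 1: translate the plaquette to the origin
    have h1 : F (k + 2) β [plaquetteWord ⟨x, ⟨(i, j), hij⟩⟩] = F (k + 2) β [plaquetteWord ⟨0, ⟨(i, j), hij⟩⟩] := by
      refine eq_of_uniform_bounds (k := k)
        (A := C (k + 1) * L (k + 1) ^ LoopSeq.len [plaquetteWord ⟨x, ⟨(i, j), hij⟩⟩])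
        (A' := C (k + 1) * L (k + 1) ^ LoopSeq.len [plaquetteWord ⟨(0 : Site d), ⟨(i, j), hij⟩⟩])
        (fun N : ℕ => phi N β (box d (r + R N + 1)) [plaquetteWord ⟨x, ⟨(i, j), hij⟩⟩])
        (fun n => F (n + 2) β [plaquetteWord ⟨x, ⟨(i, j), hij⟩⟩]) (fun n => F (n + 2) β [plaquetteWord ⟨0, ⟨(i, j), hij⟩⟩])
        (fun n hn => by rw [hlow n hn ⟨x, ⟨(i, j), hij⟩⟩, hlow n hn ⟨0, ⟨(i, j), hij⟩⟩]) (fun N hN => ?_) (fun N hN => ?_)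
      · exact hQ (k + 1) β hβ _ N hN _ (isLoopSeq_plaquette _) (hdepth (R N) r x hxr ⟨(i, j), hij⟩)
      · have ht := phi_plaquetteWord_translate (N := N) β (box d (r + R N + 1)) 0 x ⟨(i, j), hij⟩
        rw [zero_add] at ht
        simp only [ht]
        refine hQ (k + 1) β hβ _ N hN _ (isLoopSeq_plaquette _) ?_
        refine ball_shift [plaquetteWord ⟨0, ⟨(i, j), hij⟩⟩] x ?_
        rw [List.map_singleton, ← plaquetteWord_translate, zero_add]
        exact hdepth (R N) r x hxr ⟨(i, j), hij⟩
    -- step 2: rotate the axes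
    have h2 : F (k + 2) β [plaquetteWord ⟨0, ⟨(i, j), hij⟩⟩] = F (k + 2) β [plaquetteWord p₀] := by
      obtain ⟨σ, hσi, hσj⟩ := exists_perm_apply_eq hd hij
      have hσ : σ i₀ < σ j₀ := by rw [hσi, hσj]; exact hij
      have hp : (⟨0, ⟨(i, j), hij⟩⟩ : ZdPlaquette d) = ⟨(0 : Site d) ∘ ⇑σ.symm, ⟨(σ i₀, σ j₀), hσ⟩⟩ := by
        have h0 : (0 : Site d) ∘ ⇑σ.symm = 0 := by funext k; simp
        rw [h0]
        congr 1
        exact Subtype.ext (Prod.ext hσi.symm hσj.symm)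
      refine eq_of_uniform_bounds (k := k)
        (A := C (k + 1) * L (k + 1) ^ LoopSeq.len [plaquetteWord ⟨(0 : Site d), ⟨(i, j), hij⟩⟩])
        (A' := C (k + 1) * L (k + 1) ^ LoopSeq.len [plaquetteWord p₀])
        (fun N : ℕ => phi N β (box d (0 + R N + 1)) [plaquetteWord ⟨0, ⟨(i, j), hij⟩⟩])
        (fun n => F (n + 2) β [plaquetteWord ⟨0, ⟨(i, j), hij⟩⟩]) (fun n => F (n + 2) β [plaquetteWord p₀])
        (fun n hn => hlow n hn ⟨0, ⟨(i, j), hij⟩⟩) (fun N hN => ?_) (fun N hN => ?_)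
      · exact hQ (k + 1) β hβ _ N hN _ (isLoopSeq_plaquette _) (hdepth (R N) 0 0 h0box ⟨(i, j), hij⟩)
      · have hperm : phi N β (box d (0 + R N + 1)) [plaquetteWord ⟨0, ⟨(i, j), hij⟩⟩] =
            phi N β (box d (0 + R N + 1)) [plaquetteWord p₀] := by
          rw [hp]
          exact phi_plaquetteWord_perm (N := N) σ (mem_box_comp_perm_iff σ _) β 0 h01 hσ
        simp only [hperm]
        exact hQ (k + 1) β hβ _ N hN _ (isLoopSeq_plaquette _) (hdepth (R N) 0 0 h0box ⟨(i₀, j₀), h01⟩)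
    rw [h1, h2]
  -- induction on `k`, proving the statement for all levels `≤ k` at once
  suffices hmain : ∀ (k : ℕ) (β : ℝ), |β| ≤ β₀ (k + 1) → ∀ i, i ≤ k → ∀ p : ZdPlaquette d,
      F (i + 2) β [plaquetteWord p] = F (i + 2) β [plaquetteWord p₀] by
    intro k β hβ p q
    rw [hmain k β hβ k le_rfl p, hmain k β hβ k le_rfl q]
  intro k
  induction k with
  | zero =>
    intro β hβ i hi p
    obtain rfl : i = 0 := Nat.le_zero.mp hi
    exact hstep 0 β hβ (fun i hi => (Nat.not_lt_zero i hi).elim) p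
  | succ k ih =>
    intro β hβ i hi p
    have hβ' : |β| ≤ β₀ (k + 1) := hβ.trans (hanti (k + 1))
    rcases Nat.lt_or_ge i (k + 1) with hik | hik
    · exact ih β hβ' i (Nat.lt_succ_iff.mp hik) p
    · obtain rfl : i = k + 1 := le_antisymm hi hik
      exact hstep (k + 1) β hβ (fun i hi => ih β hβ' i (Nat.lt_succ_iff.mp hi)) p

end StringDuality

end Summit.QuantumFields.GaugeBoot

end
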